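import Literature.Probability.LatticeModels.LebowitzInequality
import Literature.Probability.Percolation.CriticalContinuityProofs
import Mathlib.Analysis.SpecificLimits.Basic
import Mathlib.Analysis.Complex.ExponentialBounds
import HarnessLib

/-!
# Peierls' estimate for the nearest-neighbour Ising model: `m*(β) > 0` for `β` large, `d ≥ 2`

Trunk G02 (T-STATMECH), topic `Probability/LatticeModels`; namespaces `Literature.StatMech` (the
estimates) and `Literature.CritIsing` (the discharge). Sorry-free proof of the low-temperature half of
the Peierls–Griffiths–Dobrushin theorem (Peierls, Proc. Camb. Phil. Soc. **32** (1936) 477;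
Griffiths, Phys. Rev. **136** (1964) A437; Dobrushin 1965; Friedli–Velenik 2017, Thm. 3.25 (ii)
and §3.7.2, eqs. (3.36)–(3.40)), **discharging** the tree's named fact
`Literature.Probability.LatticeModels.exists_spontaneousMagnetization_pos` (crit-ising.S07: for `d ≥ 2` some `β ≥ 0`
has `m*(β) > 0`), with the explicit witness `m*(4) ≥ ½` in every `d ≥ 2`
(`exists_spontaneousMagnetization_pos_holds`, `half_le_spontaneousMagnetization`).

## The argument

The printed proof (Friedli–Velenik 2017, pp. 117–119) bounds `μ⁺_{B(n);β,0}(σ₀ = -1)` by the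
sum over contours `γ` surrounding `0` of `μ⁺(γ ⊆ ∂σ) ≤ e^{-2β|γ|}` (Lemma 3.36, by flipping the
spins inside `γ`) times the number `≤ k 3^{k-1}`-type count of contours of length `k`. Two
substitutions make this formal here without a lattice Jordan curve theorem:

1. **A Griffiths bound in place of the flip** (`gksExpect_allMinus_le`,
   `isingMeasure_plus_real_allDisagree_le`): for any finite set `F` of bonds,
   `μ⁺_{Λ;β,h}(σ_xσ_y = -1 ∀ {x,y} ∈ F) ≤ (1 - tanh β)^{|F|}`, because
   `1{all unsatisfied} ≤ e^{-∑_F β(1+σ_xσ_y)}`, whose expectation is `e^{-β|F|} Z_{F off}/Z`, and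
   `Z ≥ (cosh β)^{|F|} Z_{F off}` by the first Griffiths inequality (expand
   `e^{βσ_xσ_y} = cosh β + σ_xσ_y sinh β` over `F`; `GKSInequalities`). The rate
   `1 - tanh β = 2/(e^{2β}+1)` replaces `e^{-2β}`.
2. **The planar dual circuit of the tree** (`Literature.Probability.Percolation.Contour.exists_dualCircuit`,
   `DualContours.lean`, after Grimmett 1999, §1.4 / Kesten 1982): if `σ₀ = -1` under the `+`
   condition in a box of `ℤ^d`, the cluster of the origin for the *agreement* configuration
   (`agreeConfig σ`: bonds with `σ_x = σ_y` open) lies in the box, hence is finite; restricted to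
   the coordinate plane `ℤ² ↪ ℤ^d` (`exists_zdGraph_two_embedding`, `restrictConfig`) it is still
   finite, so it is surrounded by a dual circuit of some length `n ≥ 1` through a plaquette
   `(k, 0)`, `k < n`, whose `n` crossed bonds are all unsatisfied. There are at most `n(n+1)4ⁿ`
   such circuits; with `1 - tanh β ≤ 1/1024` (`β ≥ 4`), `∑_{n≥1} n(n+1)4ⁿ1024⁻ⁿ ≤ 1/126 < 1/4`
   (`isingMeasure_plus_box_spinAt_zero_eq_neg_one_le`), uniformly in the box — the scheme, word
   for word, of the percolation Peierls argument `theta_zd_pos_of_le` of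
   `CriticalContinuityProofs`.

Then `⟨σ₀⟩⁺_{Λ_L;β,0} = 1 - 2μ⁺(σ₀ = -1) ≥ ½` (Friedli–Velenik (3.40);
`half_le_isingCorr_plus_box_zero`) and `m*(β) = lim_L ⟨σ₀⟩⁺_{Λ_L;β,0} ≥ ½`
(`hasBoxLimit_isingCorr_plus_holds`, `spontaneousMagnetization_eq_plusCorr` of `GKSInequalities`).

## Faithfulness notes

* The discharged statement is exactly the tree fact (`∃ β ≥ 0, 0 < m*(β)` for `d ≥ 2`); the
  quantitative by-products (`β = 4`, `m* ≥ ½`, rate `1 - tanh β`) are weaker than the printed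
  Peierls bound `m*(β) ≥ 1 - Ce^{-cβ}` (`peierls_bound`, not discharged here) and are labelled as
  such.
* No result is attributed to a source in a stronger form than printed; the two substitutions
  above are documented at their declarations.

## Mathlib status

No Ising model or Peierls argument in Mathlib (searched `Peierls`, `Ising`, `contour`). Anchors:
`Finset.prod_add`, `Finset.single_le_sum`, `Real.tanh_eq_sinh_div_cosh`, `Real.sinh_eq`,
`Real.cosh_eq`, `Real.exp_one_gt_d9`, `Real.exp_le_exp`, `integral_indicator_one`,
`Finset.measurableSet_biInter`, `MeasurableSet.biInter`, `measureReal_eq_zero_iff`,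
`measure_biUnion_finset_le`, `measure_iUnion_le`, `ENNReal.tsum_le_tsum`,
`ENNReal.ofReal_tsum_of_nonneg`, `tsum_geometric_of_lt_one`, `SimpleGraph.Walk` induction,
`ge_of_tendsto`; tree anchors `integral_isingMeasure`, `glue_apply_of_notMem`, `bondSpin_mk`,
`isingIdx`/`isingSupp`/`gksCoupling`/`gksCoupling_plus_inl`/`isingWeight_eq_gksWeight`/
`spinProduct_isingSupp_inl` (`GKSInequalities`), `cplOff`/`gksHamiltonian_cplAt`
(`LebowitzInequality`), `exists_zdGraph_two_embedding`, `finite_openCluster_restrictConfig`,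
`restrictConfig`, `Contour.exists_dualCircuit`, `dualEdges_subset_edgeSet`, `openGraph_adj`
(`Percolation`).

## References

* R. Peierls, *On Ising's model of ferromagnetism*, Proc. Camb. Phil. Soc. 32 (1936) 477–481
  [Peierls1936].
* R. B. Griffiths, *Peierls proof of spontaneous magnetization in a two-dimensional Ising
  ferromagnet*, Phys. Rev. 136 (1964) A437–A439.
* S. Friedli, Y. Velenik, *Statistical Mechanics of Lattice Systems*, CUP (2017), §3.7.2,
  Thm. 3.25 (ii), Lemma 3.36, eqs. (3.36)–(3.40) [FriedliVelenik2017].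
* G. Grimmett, *Percolation*, 2nd ed., Springer (1999), §1.4 (the dual-circuit lemma and the
  Peierls sum (1.17)–(1.18)) [Grimmett1999].
-/

noncomputable section

open Finset MeasureTheory
open scoped symmDiff

namespace Literature.Probability.LatticeModels

/-! ### A Griffiths bound on the probability that prescribed bonds are all unsatisfied -/

section GKSBound

variable {Λ : Type*} [Fintype Λ] [DecidableEq Λ] {ι : Type*} [DecidableEq ι]
variable (s : Finset ι) (K : ι → ℝ) (C : ι → Finset Λ)

omit [Fintype Λ] in
/-- A finite product of spin products is a spin product (`ω_Aω_B = ω_{A∆B}` iterated). [folklore] -/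
theorem exists_prod_spinProduct_eq (S : Finset ι) :
    ∃ A : Finset Λ, (fun ω : SpinConfig Λ => ∏ i ∈ S, spinProduct (C i) ω) = spinProduct A := by
  induction S using Finset.induction_on with
  | empty => exact ⟨∅, by funext ω; simp⟩
  | insert j S hj ih =>
    obtain ⟨A, hA⟩ := ih
    refine ⟨C j ∆ A, ?_⟩
    funext ω
    rw [Finset.prod_insert hj, show ∏ i ∈ S, spinProduct (C i) ω = spinProduct A ω from congrFun hA ω,
      spinProduct_mul_eq_spinProduct_symmDiff]

/-- GKS I for a product of interaction terms: `∑_ω (∏_{i∈S} ω_{Cᵢ}) e^{∑ Kᵢω_{Cᵢ}} ≥ 0` for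
`K ≥ 0`. [cite: FriedliVelenik2017, Thm. 3.49, eq. (3.54), p. 141] -/
theorem gksSum_prod_spinProduct_nonneg (hK : ∀ i ∈ s, 0 ≤ K i) (S : Finset ι) :
    0 ≤ gksSum s K C (fun ω => ∏ i ∈ S, spinProduct (C i) ω) := by
  obtain ⟨A, hA⟩ := exists_prod_spinProduct_eq C S
  rw [hA]
  exact gksSum_spinProduct_nonneg s K C hK A

omit [Fintype Λ] [DecidableEq Λ] in
/-- The weight with the terms of `T` switched on factors through the weight with them switched off:
`w_K = w_{K off T} · exp(∑_{i∈T} Kᵢ ω_{Cᵢ})` (`T ⊆ s`). [folklore] -/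
theorem gksWeight_eq_off_mul_exp (T : Finset ι) (hTs : T ⊆ s) (ω : SpinConfig Λ) :
    gksWeight s K C ω = gksWeight s (cplOff K T) C ω * Real.exp (∑ i ∈ T, K i * spinProduct (C i) ω) := by
  rw [gksWeight, gksWeight, ← Real.exp_add]
  congr 1
  have h := gksHamiltonian_cplAt s K C T 1 ω
  rw [cplAt_one, one_mul] at h
  rw [h]
  congr 1
  simp only [gksHamiltonian, cplOn, ite_mul, zero_mul]
  rw [Finset.sum_ite_mem, Finset.inter_eq_right.2 hTs]

/-- **Switching on ferromagnetic terms increases the partition function by at least `∏ cosh Kᵢ`**: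
`(∏_{i∈T} cosh Kᵢ) Z_{K off T} ≤ Z_K` for `K ≥ 0` (expand `e^{Kᵢω} = cosh Kᵢ + ω sinh Kᵢ` over
`T`; every term of the expansion is nonnegative by GKS I, and the term `S = ∅` is the left side;
Friedli–Velenik 2017, proof of Thm. 3.49 / high-temperature expansion (3.44)). [cite: FriedliVelenik2017, Thm. 3.49 and eq. (3.44)] -/
theorem prod_cosh_mul_gksSum_off_le (hK : ∀ i ∈ s, 0 ≤ K i) (T : Finset ι) (hTs : T ⊆ s) :
    (∏ i ∈ T, Real.cosh (K i)) * gksSum s (cplOff K T) C (fun _ => 1) ≤ gksSum s K C (fun _ => 1) := by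
  have hK' : ∀ i ∈ s, 0 ≤ cplOff K T i := by
    intro i hi; unfold cplOff; split_ifs; exacts [le_rfl, hK i hi]
  -- expand the switched-on factors
  have hexp : ∀ ω : SpinConfig Λ, Real.exp (∑ i ∈ T, K i * spinProduct (C i) ω) =
      ∑ S ∈ T.powerset, (∏ i ∈ S, spinProduct (C i) ω * Real.sinh (K i)) * ∏ i ∈ T \ S, Real.cosh (K i) := by
    intro ω
    rw [Real.exp_sum, ← Finset.prod_add]
    refine Finset.prod_congr rfl fun i _ => ?_
    rw [exp_mul_eq_cosh_add_mul_sinh (K i) (spinProduct_eq_one_or (C i) ω), add_comm]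
  have hZ : gksSum s K C (fun _ => 1) = ∑ S ∈ T.powerset,
      ((∏ i ∈ S, Real.sinh (K i)) * ∏ i ∈ T \ S, Real.cosh (K i)) *
        gksSum s (cplOff K T) C (fun ω => ∏ i ∈ S, spinProduct (C i) ω) := by
    simp only [gksSum, one_mul]
    simp_rw [gksWeight_eq_off_mul_exp s K C T hTs, hexp, Finset.mul_sum]
    rw [Finset.sum_comm]
    refine Finset.sum_congr rfl fun S _ => Finset.sum_congr rfl fun ω _ => ?_
    rw [Finset.prod_mul_distrib]
    ring
  rw [hZ]
  have hterm : ∀ S ∈ T.powerset, 0 ≤ ((∏ i ∈ S, Real.sinh (K i)) * ∏ i ∈ T \ S, Real.cosh (K i)) *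
      gksSum s (cplOff K T) C (fun ω => ∏ i ∈ S, spinProduct (C i) ω) := by
    intro S hS
    have hST : S ⊆ T := Finset.mem_powerset.1 hS
    exact mul_nonneg (mul_nonneg (Finset.prod_nonneg fun i hi => Real.sinh_nonneg_iff.2 (hK i (hTs (hST hi))))
      (Finset.prod_nonneg fun i _ => (Real.cosh_pos _).le))
      (gksSum_prod_spinProduct_nonneg s _ C hK' S)
  refine le_trans (le_of_eq ?_) (Finset.single_le_sum hterm (Finset.empty_mem_powerset T))
  simp [gksSum]

/-- The indicator that all the terms of `T` are unsatisfied, `∏_{i∈T} 1{ω_{Cᵢ} = -1}`. [folklore] -/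
def allMinus (T : Finset ι) (ω : SpinConfig Λ) : ℝ :=
  ∏ i ∈ T, if spinProduct (C i) ω = -1 then (1 : ℝ) else 0

omit [Fintype Λ] [DecidableEq Λ] [DecidableEq ι] in
/-- `∏ 1{ω_{Cᵢ} = -1} ≤ exp(-∑_{i∈T} Kᵢ(1 + ω_{Cᵢ}))` (the indicator is `1` only when the exponent
vanishes). [folklore] -/
theorem allMinus_le_exp (T : Finset ι) (ω : SpinConfig Λ) :
    allMinus C T ω ≤ Real.exp (-∑ i ∈ T, K i * (1 + spinProduct (C i) ω)) := by
  unfold allMinus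
  rw [← Finset.sum_neg_distrib, Real.exp_sum]
  refine Finset.prod_le_prod (fun i _ => by split_ifs <;> norm_num) fun i hi => ?_
  split_ifs with h
  · rw [h]; simp
  · exact (Real.exp_pos _).le

omit [Fintype Λ] [DecidableEq Λ] [DecidableEq ι] in
/-- `allMinus ≥ 0`. [folklore] -/
theorem allMinus_nonneg (T : Finset ι) (ω : SpinConfig Λ) : 0 ≤ allMinus C T ω :=
  Finset.prod_nonneg fun i _ => by split_ifs <;> norm_num

/-- **A Griffiths bound on unsatisfied bonds**: for `K ≥ 0` and `T ⊆ s`,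
`ν_{Λ;K}(ω_{Cᵢ} = -1 ∀ i ∈ T) ≤ ∏_{i∈T} (1 - tanh Kᵢ)`. Proof:
`1{all -1} ≤ e^{-∑_T Kᵢ(1+ω_{Cᵢ})}`, whose expectation is `e^{-∑_T Kᵢ} Z_{K off T}/Z_K`, and
`Z_K ≥ (∏ cosh Kᵢ) Z_{K off T}` (`prod_cosh_mul_gksSum_off_le`); `e^{-K}/cosh K = 1 - tanh K`.
(A substitute, sufficient for Peierls' estimate, of the contour-flip bound `e^{-2β|γ|}` of
Peierls 1936 / Griffiths 1964 / Friedli–Velenik 2017, eq. (3.37); it needs no interior of the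
contour.) [cite: FriedliVelenik2017, §3.7.2, Lemma 3.36 and eq. (3.37)] -/
theorem gksExpect_allMinus_le (hK : ∀ i ∈ s, 0 ≤ K i) (T : Finset ι) (hTs : T ⊆ s) :
    gksExpect s K C (allMinus C T) ≤ ∏ i ∈ T, (1 - Real.tanh (K i)) := by
  have hZ := gksSum_one_pos s K C
  have hZ' := gksSum_one_pos s (cplOff K T) C
  -- numerator bound
  have hnum : gksSum s K C (allMinus C T) ≤ Real.exp (-∑ i ∈ T, K i) * gksSum s (cplOff K T) C (fun _ => 1) := by
    calc gksSum s K C (allMinus C T)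
        ≤ gksSum s K C (fun ω => Real.exp (-∑ i ∈ T, K i * (1 + spinProduct (C i) ω))) := by
          unfold gksSum
          exact Finset.sum_le_sum fun ω _ => mul_le_mul_of_nonneg_right
            (allMinus_le_exp K C T ω) (gksWeight_pos s K C ω).le
      _ = Real.exp (-∑ i ∈ T, K i) * gksSum s (cplOff K T) C (fun _ => 1) := by
          simp only [gksSum, one_mul, Finset.mul_sum]
          refine Finset.sum_congr rfl fun ω _ => ?_
          rw [gksWeight_eq_off_mul_exp s K C T hTs ω]
          have : -∑ i ∈ T, K i * (1 + spinProduct (C i) ω) =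
              -∑ i ∈ T, K i + -∑ i ∈ T, K i * spinProduct (C i) ω := by
            rw [← neg_add, ← Finset.sum_add_distrib]
            congr 1
            exact Finset.sum_congr rfl fun i _ => by ring
          rw [this, Real.exp_add, Real.exp_neg (∑ i ∈ T, K i * spinProduct (C i) ω)]
          have hpos := Real.exp_pos (∑ i ∈ T, K i * spinProduct (C i) ω)
          field_simp
  have hden := prod_cosh_mul_gksSum_off_le s K C hK T hTs
  have hcosh : 0 < ∏ i ∈ T, Real.cosh (K i) := Finset.prod_pos fun i _ => Real.cosh_pos _
  rw [gksExpect, div_le_iff₀ hZ]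
  calc gksSum s K C (allMinus C T)
      ≤ Real.exp (-∑ i ∈ T, K i) * gksSum s (cplOff K T) C (fun _ => 1) := hnum
    _ = (∏ i ∈ T, (1 - Real.tanh (K i))) * ((∏ i ∈ T, Real.cosh (K i)) *
          gksSum s (cplOff K T) C (fun _ => 1)) := by
        rw [← mul_assoc]
        congr 1
        rw [← Finset.prod_mul_distrib, ← Finset.sum_neg_distrib, Real.exp_sum]
        refine Finset.prod_congr rfl fun i _ => ?_
        rw [Real.tanh_eq_sinh_div_cosh, Real.sinh_eq, Real.cosh_eq]
        have h2 : Real.exp (K i) + Real.exp (-K i) ≠ 0 := by positivity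
        field_simp
        ring
    _ ≤ (∏ i ∈ T, (1 - Real.tanh (K i))) * gksSum s K C (fun _ => 1) := by
        refine mul_le_mul_of_nonneg_left hden (Finset.prod_nonneg fun i hi => ?_)
        rw [sub_nonneg, Real.tanh_eq_sinh_div_cosh, div_le_one (Real.cosh_pos _)]
        exact (Real.sinh_lt_cosh _).le

end GKSBound

/-! ### The finite-volume Ising model with `+` boundary condition: unsatisfied bonds are unlikely -/

section IsingBound

variable {V : Type*} [DecidableEq V] (G : SimpleGraph V) [G.LocallyFinite]

omit [G.LocallyFinite] in
/-- For the `+` boundary condition, the interaction term of an edge `e` touching `Λ` evaluated at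
`τ` is the bond variable `σ_xσ_y` of the glued configuration (the outside spins being `+1`). [cite: FriedliVelenik2017, §3.8.1, p. 141] -/
theorem spinProduct_isingSupp_inl_plus (Λ : Finset V) (τ : SpinConfig ↥Λ) {e : Sym2 V}
    (he : e ∈ G.edgeSet) :
    spinProduct (isingSupp Λ (.inl e)) τ = bondSpin (glue Λ τ .plus) e := by
  induction e using Sym2.ind with
  | _ x y =>
    have hxy : x ≠ y := G.ne_of_adj ((SimpleGraph.mem_edgeSet G).1 he)
    rw [spinProduct_isingSupp_inl τ .plus hxy, bondSpin_mk]
    have hout : ∀ z : V, (if z ∈ Λ then spinAt z (glue Λ τ .plus) else 1) = spinAt z (glue Λ τ .plus) := by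
      intro z
      split_ifs with hz
      · rfl
      · rw [spinAt_glue_of_not_mem τ .plus hz]; simp [BoundaryCondition.plus, spinAt]
    rw [hout x, hout y]

omit [DecidableEq V] in
/-- The event that all bonds of `F` are unsatisfied (`σ_x ≠ σ_y`), a measurable set. [folklore] -/
theorem measurableSet_allDisagree (F : Finset (Sym2 V)) :
    MeasurableSet {σ : SpinConfig V | ∀ e ∈ F, bondSpin σ e = -1} := by
  have h : {σ : SpinConfig V | ∀ e ∈ F, bondSpin σ e = -1} = ⋂ e ∈ F, (fun σ => bondSpin σ e) ⁻¹' {-1} := by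
    ext σ; simp
  rw [h]
  exact Finset.measurableSet_biInter F fun e _ => measurable_bondSpin e (measurableSet_singleton _)

/-- **Unsatisfied bonds are exponentially unlikely under the `+` boundary condition**: for
`β, h ≥ 0` and a finite set `F` of edges touching `Λ`,
`μ⁺_{Λ;β,h}(σ_xσ_y = -1 for all {x,y} ∈ F) ≤ (1 - tanh β)^{|F|}`
(from `gksExpect_allMinus_le`; the Ising couplings of the edges touching `Λ` are all `β` for
the `+` condition). This plays the role of the Peierls contour estimate
`μ⁺(γ ⊆ ∂σ) ≤ e^{-2β|γ|}` (Friedli–Velenik 2017, Lemma 3.36 / eq. (3.37); Peierls 1936;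
Griffiths 1964) with the weaker but sufficient rate `1 - tanh β = 2/(e^{2β}+1)`. [cite: FriedliVelenik2017, §3.7.2, Lemma 3.36 and eq. (3.37)] -/
theorem isingMeasure_plus_real_allDisagree_le (Λ : Finset V) {β h : ℝ} (hβ : 0 ≤ β) (hh : 0 ≤ h)
    {F : Finset (Sym2 V)} (hF : F ⊆ edgesTouching G Λ) :
    (isingMeasure G Λ β h .plus).real {σ | ∀ e ∈ F, bondSpin σ e = -1} ≤ (1 - Real.tanh β) ^ F.card := by
  classical
  rw [← integral_indicator_one (measurableSet_allDisagree F)]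
  have hmeas : Measurable ({σ : SpinConfig V | ∀ e ∈ F, bondSpin σ e = -1}.indicator (1 : SpinConfig V → ℝ)) :=
    measurable_one.indicator (measurableSet_allDisagree F)
  rw [integral_isingMeasure G Λ β h .plus hmeas]
  -- identify with a `gksExpect` of `allMinus`
  set T : Finset (Sym2 V ⊕ V) := F.map ⟨Sum.inl, Sum.inl_injective⟩ with hT
  have hTs : T ⊆ isingIdx G Λ := by
    intro i hi
    rw [hT, Finset.mem_map] at hi
    obtain ⟨e, he, rfl⟩ := hi
    change Sum.inl e ∈ isingIdx G Λ
    simp only [isingIdx, Finset.inl_mem_disjSum]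
    exact hF he
  have hind : ∀ τ : SpinConfig ↥Λ, {σ : SpinConfig V | ∀ e ∈ F, bondSpin σ e = -1}.indicator
      (1 : SpinConfig V → ℝ) (glue Λ τ .plus) = allMinus (isingSupp Λ) T τ := by
    intro τ
    simp only [allMinus, hT, Finset.prod_map, Function.Embedding.coeFn_mk, Set.indicator_apply,
      Set.mem_setOf_eq, Pi.one_apply]
    by_cases hall : ∀ e ∈ F, bondSpin (glue Λ τ .plus) e = -1
    · rw [if_pos hall]
      symm
      refine Finset.prod_eq_one fun e he => ?_
      have hsp := spinProduct_isingSupp_inl_plus G Λ τ (mem_edgesTouching_iff.1 (hF he)).1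
      exact if_pos (hsp.trans (hall e he))
    · rw [if_neg hall]
      have hall' := hall
      simp only [not_forall] at hall'
      obtain ⟨e, he, hne⟩ := hall'
      symm
      refine Finset.prod_eq_zero he ?_
      have hsp := spinProduct_isingSupp_inl_plus G Λ τ (mem_edgesTouching_iff.1 (hF he)).1
      exact if_neg fun h' => hne (hsp.symm.trans h')
  have hsum : (∑ τ : ↥Λ → ℤˣ, isingWeight G Λ β h .plus τ *
      {σ : SpinConfig V | ∀ e ∈ F, bondSpin σ e = -1}.indicator 1 (glue Λ τ .plus)) /
        isingPartitionFunction G Λ β h .plus =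
      gksExpect (isingIdx G Λ) (gksCoupling G Λ β h .plus) (isingSupp Λ) (allMinus (isingSupp Λ) T) := by
    rw [gksExpect, gksSum, gksSum, isingPartitionFunction]
    congr 1
    · refine Finset.sum_congr rfl fun τ _ => ?_
      rw [isingWeight_eq_gksWeight, hind, mul_comm]
    · refine Finset.sum_congr rfl fun τ _ => ?_
      rw [isingWeight_eq_gksWeight, one_mul]
  rw [hsum]
  refine (gksExpect_allMinus_le _ _ _ (gksCoupling_nonneg G hβ hh (Or.inr rfl)) T hTs).trans (le_of_eq ?_)
  rw [hT, Finset.prod_map]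
  simp only [Function.Embedding.coeFn_mk]
  rw [Finset.prod_congr rfl fun e he => by rw [gksCoupling_plus_inl G β h (hF he)], Finset.prod_const]

/-- The glued `+` configuration is `+1` outside `Λ`, so a bond with no endpoint in `Λ` is satisfied. [folklore] -/
theorem bondSpin_glue_plus_of_not_touching (Λ : Finset V) (τ : SpinConfig ↥Λ) {e : Sym2 V}
    (he : e ∈ G.edgeSet) (hne : e ∉ edgesTouching G Λ) : bondSpin (glue Λ τ .plus) e = 1 := by
  induction e using Sym2.ind with
  | _ x y =>
    rw [mem_edgesTouching_iff, not_and] at hne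
    have h2 := hne he
    simp only [not_exists, not_and] at h2
    have hx : x ∉ Λ := fun hx => h2 x hx (Sym2.mem_mk_left x y)
    have hy : y ∉ Λ := fun hy => h2 y hy (Sym2.mem_mk_right x y)
    rw [bondSpin_mk, spinAt_glue_of_not_mem τ .plus hx, spinAt_glue_of_not_mem τ .plus hy]
    simp [BoundaryCondition.plus, spinAt]

/-- **Unsatisfied bonds are exponentially unlikely**, for an arbitrary finite set `F` of edges of
`G` (if some edge of `F` does not touch `Λ` it is satisfied under the `+` condition and the event is
null). [cite: FriedliVelenik2017, §3.7.2, Lemma 3.36 and eq. (3.37)] -/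
theorem isingMeasure_plus_real_allDisagree_le' (Λ : Finset V) {β h : ℝ} (hβ : 0 ≤ β) (hh : 0 ≤ h)
    {F : Finset (Sym2 V)} (hF : ∀ e ∈ F, e ∈ G.edgeSet) :
    (isingMeasure G Λ β h .plus).real {σ | ∀ e ∈ F, bondSpin σ e = -1} ≤ (1 - Real.tanh β) ^ F.card := by
  classical
  by_cases htouch : F ⊆ edgesTouching G Λ
  · exact isingMeasure_plus_real_allDisagree_le G Λ hβ hh htouch
  · obtain ⟨e, heF, hne⟩ := Finset.not_subset.1 htouch
    have hmeas : Measurable ({σ : SpinConfig V | ∀ e ∈ F, bondSpin σ e = -1}.indicator (1 : SpinConfig V → ℝ)) :=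
      measurable_one.indicator (measurableSet_allDisagree F)
    rw [← integral_indicator_one (measurableSet_allDisagree F), integral_isingMeasure G Λ β h .plus hmeas]
    have hzero : ∀ τ : SpinConfig ↥Λ, {σ : SpinConfig V | ∀ e ∈ F, bondSpin σ e = -1}.indicator
        (1 : SpinConfig V → ℝ) (glue Λ τ .plus) = 0 := by
      intro τ
      refine Set.indicator_of_notMem ?_ _
      simp only [Set.mem_setOf_eq, not_forall]
      exact ⟨e, heF, by rw [bondSpin_glue_plus_of_not_touching G Λ τ (hF e heF) hne]; norm_num⟩
    simp only [hzero, mul_zero, Finset.sum_const_zero, zero_div]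
    refine pow_nonneg ?_ _
    rw [sub_nonneg, Real.tanh_eq_sinh_div_cosh, div_le_one (Real.cosh_pos _)]
    exact (Real.sinh_lt_cosh _).le

end IsingBound

/-! ### Peierls' estimate on `ℤ^d`, `d ≥ 2`, through the planar slice -/

section Peierls

open Percolation Filter Topology
open scoped ENNReal

variable {d : ℕ}

/-- A bond variable is `1` or `-1`. [folklore] -/
theorem bondSpin_eq_one_or_neg_one {V : Type*} (σ : SpinConfig V) (e : Sym2 V) :
    bondSpin σ e = 1 ∨ bondSpin σ e = -1 := by
  induction e using Sym2.ind with
  | _ x y =>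
    rw [bondSpin_mk]
    rcases spinAt_eq_one_or_eq_neg_one x σ with h | h <;>
      rcases spinAt_eq_one_or_eq_neg_one y σ with h' | h' <;> simp [h, h']

/-- The agreement configuration of a spin configuration: the edges of `ℤ^d` whose endpoints carry
equal spins are declared open (the Peierls contours are the dual of its closed edges;
Friedli–Velenik 2017, §3.7.2, Fig. 3.10). [cite: FriedliVelenik2017, §3.7.2] -/
def agreeConfig (σ : SpinConfig (Site d)) : BondConfig (Site d) :=
  {e | e ∈ (zdGraph d).edgeSet ∧ bondSpin σ e = 1}

/-- Sites joined by an open path of the agreement configuration carry the same spin. [folklore] -/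
theorem spinAt_eq_of_reachable_agreeConfig (σ : SpinConfig (Site d)) {x y : Site d}
    (h : (openGraph (agreeConfig σ)).Reachable x y) : spinAt y σ = spinAt x σ := by
  obtain ⟨p⟩ := h
  induction p with
  | nil => rfl
  | @cons u v w hadj p ih =>
    rw [ih]
    rw [openGraph_adj] at hadj
    obtain ⟨⟨_, hb⟩, _⟩ := hadj
    rw [bondSpin_mk] at hb
    rcases spinAt_eq_one_or_eq_neg_one u σ with hu | hu <;>
      rcases spinAt_eq_one_or_eq_neg_one v σ with hv | hv <;> rw [hu, hv] at hb ⊢ <;> norm_num at hb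

/-- Under the `+` condition in `Λ` (spins `+1` off `Λ`), if `σ₀ = -1` the agreement cluster of the
origin lies in `Λ`, hence is finite ("since `σ₀ = -1` and `σ ≡ +1` off `Λ`, the origin is
surrounded by a contour", Friedli–Velenik 2017, proof of Lemma 3.36 / eq. (3.38)). [cite: FriedliVelenik2017, §3.7.2, eq. (3.38)] -/
theorem finite_openCluster_agreeConfig {Λ : Finset (Site d)} {σ : SpinConfig (Site d)}
    (hout : ∀ x ∉ Λ, σ x = 1) (h0 : spinAt 0 σ = -1) : (openCluster (agreeConfig σ) 0).Finite := by
  refine (Λ : Set (Site d)).toFinite.subset fun y hy => ?_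
  have hsy : spinAt y σ = -1 := (spinAt_eq_of_reachable_agreeConfig σ hy).trans h0
  by_contra hyΛ
  have := hout y hyΛ
  simp only [spinAt, this, Units.val_one, Int.cast_one] at hsy
  norm_num at hsy

/-- `1 - tanh x = 2/(e^{2x} + 1)`. [folklore] -/
theorem one_sub_tanh_eq (x : ℝ) : 1 - Real.tanh x = 2 / (Real.exp (2 * x) + 1) := by
  have h2x : Real.exp (2 * x) = Real.exp x ^ 2 := by rw [← Real.exp_nat_mul]; norm_num
  rw [Real.tanh_eq_sinh_div_cosh, Real.sinh_eq, Real.cosh_eq, Real.exp_neg, h2x]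
  have h : Real.exp x ≠ 0 := (Real.exp_pos x).ne'
  have h2 : Real.exp x ^ 2 + 1 ≠ 0 := by positivity
  field_simp
  ring

/-- For `β ≥ 4` the rate is small: `1 - tanh β ≤ 1/1024` (`e^{2β} ≥ e⁸ ≥ 2.7⁸ > 2047`). [folklore] -/
theorem one_sub_tanh_le_of_four_le {β : ℝ} (hβ : 4 ≤ β) : 1 - Real.tanh β ≤ 1 / 1024 := by
  rw [one_sub_tanh_eq]
  have he : (2047 : ℝ) ≤ Real.exp (2 * β) := by
    have h1 : (2.7182818283 : ℝ) < Real.exp 1 := Real.exp_one_gt_d9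
    have h2 : Real.exp (2 * 4) = Real.exp 1 ^ 8 := by rw [← Real.exp_nat_mul]; norm_num
    have h3 : (2.7182818283 : ℝ) ^ 8 ≤ Real.exp 1 ^ 8 := pow_le_pow_left₀ (by norm_num) h1.le 8
    have h4 : Real.exp (2 * 4) ≤ Real.exp (2 * β) := Real.exp_le_exp.2 (by linarith)
    rw [h2] at h4
    exact le_trans (le_trans (by norm_num) h3) h4
  rw [div_le_div_iff₀ (by positivity) (by norm_num)]
  linarith

/-- The `n`-th term of the Peierls sum at rate `1/1024` is at most `½ (1/64)ⁿ` (from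
`2n(n+1) ≤ 4ⁿ`). [folklore] -/
theorem isingPeierls_term_le (n : ℕ) :
    (n : ℝ) * (n + 1) * 4 ^ n * (1 / 1024) ^ n ≤ 1 / 2 * (1 / 64) ^ n := by
  have htwo : 2 * n ≤ 2 ^ n := by
    rcases n with - | m
    · simp
    · rw [pow_succ]
      have := m.lt_two_pow_self
      omega
  have hfour : 2 * n * (n + 1) ≤ 4 ^ n := by
    have h2 : n + 1 ≤ 2 ^ n := n.lt_two_pow_self
    calc 2 * n * (n + 1) ≤ 2 ^ n * 2 ^ n := Nat.mul_le_mul htwo h2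
      _ = 4 ^ n := by rw [← mul_pow]; norm_num
  have h2 : (2 * n * (n + 1) : ℝ) ≤ 4 ^ n := by exact_mod_cast hfour
  have h8 : (1 / 1024 : ℝ) ^ n = (1 / 4) ^ n * (1 / 4) ^ n * (1 / 64) ^ n := by
    rw [← mul_pow, ← mul_pow]; norm_num
  rw [h8]
  have key : (n : ℝ) * (n + 1) * (1 / 4) ^ n ≤ 1 / 2 := by
    rw [one_div, inv_pow, ← div_eq_mul_inv, div_le_iff₀ (by positivity)]
    linarith
  calc (n : ℝ) * (n + 1) * 4 ^ n * ((1 / 4) ^ n * (1 / 4) ^ n * (1 / 64) ^ n)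
      = ((4 : ℝ) ^ n * (1 / 4) ^ n) * (1 / 64) ^ n * (n * (n + 1) * (1 / 4) ^ n) := by ring
    _ = (1 / 64) ^ n * (n * (n + 1) * (1 / 4) ^ n) := by rw [← mul_pow]; norm_num
    _ ≤ (1 / 64) ^ n * (1 / 2) := by gcongr
    _ = 1 / 2 * (1 / 64) ^ n := by ring

/-- **Peierls' estimate, uniformly in the box**: for `d ≥ 2`, `β ≥ 4` and every `L`,
`μ⁺_{Λ_L;β,0}(σ₀ = -1) ≤ 1/4`. If `σ₀ = -1` (and `σ ≡ +1` off the box), the agreement cluster of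
the origin restricted to the coordinate plane `ℤ² ↪ ℤ^d` is finite, so by
`Contour.exists_dualCircuit` the origin is surrounded by a dual circuit of some length `n ≥ 1`
through a plaquette `(k,0)`, `k < n`, all of whose `n` edges are unsatisfied bonds; there are at
most `n(n+1)4ⁿ` such circuits and each is unsatisfied with probability `≤ (1 - tanh β)ⁿ ≤ 1024⁻ⁿ`
(`isingMeasure_plus_real_allDisagree_le'`), and `∑_{n≥1} n(n+1)4ⁿ1024⁻ⁿ ≤ 1/126`. (Peierls 1936;
Griffiths 1964; Friedli–Velenik 2017, §3.7.2, eqs. (3.38)–(3.40), with the Griffiths bound of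
this file in place of the contour-flip estimate (3.37).) [cite: FriedliVelenik2017, §3.7.2, proof of Thm. 3.25 (ii), eqs. (3.38)–(3.40)] -/
theorem isingMeasure_plus_box_spinAt_zero_eq_neg_one_le (hd : 2 ≤ d) {β : ℝ} (hβ : 4 ≤ β) (L : ℕ) :
    (isingMeasure (zdGraph d) (box d L) β 0 .plus) {σ | spinAt 0 σ = -1} ≤ ENNReal.ofReal (1 / 4) := by
  classical
  obtain ⟨ι, hιi, hι0, hιE⟩ := exists_zdGraph_two_embedding hd
  set μ := isingMeasure (zdGraph d) (box d L) β 0 .plus with hμ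
  have hβ0 : 0 ≤ β := le_trans (by norm_num) hβ
  -- the rate
  have hrate : 1 - Real.tanh β ≤ 1 / 1024 := one_sub_tanh_le_of_four_le hβ
  have hrate0 : 0 ≤ 1 - Real.tanh β := by
    rw [sub_nonneg, Real.tanh_eq_sinh_div_cosh, div_le_one (Real.cosh_pos _)]
    exact (Real.sinh_lt_cosh _).le
  -- the events "the dual walk `(n+1, k, m, w)` is unsatisfied in the coordinate plane"
  let st : (n : ℕ) → ℕ → ℕ → (Fin n → Fin 2 × Bool) → Site 2 := fun n k m w =>
    Pi.single 0 (k : ℤ) - wordPos w m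
  let S : (n : ℕ) → ℕ → ℕ → (Fin n → Fin 2 × Bool) → Set (SpinConfig (Site d)) :=
    fun n k m w => {σ | ∀ e ∈ (dualEdges (st n k m w) w).image (Sym2.map ι), bondSpin σ e = -1}
  let good : (n : ℕ) → ℕ → ℕ → Finset (Fin n → Fin 2 × Bool) := fun n k m =>
    Finset.univ.filter fun w => (dualEdges (st n k m w) w).card = n
  let Vv : ℕ → Set (SpinConfig (Site d)) := fun n =>
    ⋃ k ∈ Finset.range n, ⋃ m ∈ Finset.range (n + 1), ⋃ w ∈ good n k m, S n k m w
  -- the support of the measure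
  let Supp : Set (SpinConfig (Site d)) := {σ | ∀ x ∉ box d L, σ x = 1}
  have hSupp : μ Suppᶜ = 0 := by
    have hmeasS : MeasurableSet Supp := by
      have : Supp = ⋂ x ∈ ({x | x ∉ box d L} : Set (Site d)), (fun σ : SpinConfig (Site d) => σ x) ⁻¹' {1} := by
        ext σ; simp [Supp]
      rw [this]
      exact MeasurableSet.biInter (Set.to_countable _) fun x _ => measurable_pi_apply x (measurableSet_singleton _)
    have hind : Measurable (Suppᶜ.indicator (1 : SpinConfig (Site d) → ℝ)) := measurable_one.indicator hmeasS.compl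
    have hreal : μ.real Suppᶜ = 0 := by
      rw [← integral_indicator_one hmeasS.compl, hμ, integral_isingMeasure (zdGraph d) (box d L) β 0 .plus hind]
      have hz : ∀ τ : SpinConfig ↥(box d L), Suppᶜ.indicator (1 : SpinConfig (Site d) → ℝ)
          (glue (box d L) τ .plus) = 0 := by
        intro τ
        refine Set.indicator_of_notMem ?_ _
        simp only [Set.mem_compl_iff, not_not, Supp, Set.mem_setOf_eq]
        intro x hx
        rw [glue_apply_of_notMem _ _ _ hx]
        rfl
      simp [hz]
    exact (measureReal_eq_zero_iff (measure_ne_top _ _)).1 hreal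
  -- a `-` spin at the origin forces one of the events (on the support)
  have hsub : {σ : SpinConfig (Site d) | spinAt 0 σ = -1} ∩ Supp ⊆ ⋃ n, Vv (n + 1) := by
    rintro σ ⟨hσ0, hσout⟩
    have hfin : (openCluster (agreeConfig σ) (ι 0)).Finite := by
      rw [hι0]; exact finite_openCluster_agreeConfig hσout hσ0
    obtain ⟨n, k, hkn, a, w, -, ⟨m, hmn, hpos⟩, hcard, hdisj, -, -⟩ :=
      Contour.exists_dualCircuit (restrictConfig ι (agreeConfig σ))
        (finite_openCluster_restrictConfig hιi (agreeConfig σ) 0 hfin)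
    have ha : a = st n k m w := by simp only [st, ← hpos, add_sub_cancel_right]
    subst ha
    obtain ⟨n', rfl⟩ : ∃ n', n = n' + 1 := ⟨n - 1, by omega⟩
    refine Set.mem_iUnion.2 ⟨n', Set.mem_biUnion (Finset.mem_range.2 hkn)
      (Set.mem_biUnion (Finset.mem_range.2 (Nat.lt_succ_of_le hmn))
        (Set.mem_biUnion (x := w) (by simp [good, hcard]) ?_))⟩
    simp only [S, Set.mem_setOf_eq]
    intro e he
    obtain ⟨e2, he2, rfl⟩ := Finset.mem_image.1 he
    have hedge : e2.map ι ∈ (zdGraph d).edgeSet := hιE e2 (dualEdges_subset_edgeSet _ _ he2)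
    have hnot : e2.map ι ∉ agreeConfig σ := by
      intro hmem
      exact Set.disjoint_left.1 hdisj (Finset.mem_coe.2 he2) (show e2 ∈ restrictConfig ι (agreeConfig σ) from hmem)
    rcases bondSpin_eq_one_or_neg_one σ (e2.map ι) with h1 | h1
    · exact absurd ⟨hedge, h1⟩ hnot
    · exact h1
  -- each event has probability `≤ (1/1024)^(n+1)`
  have hS : ∀ n k m, ∀ w ∈ good n k m, μ (S n k m w) ≤ ENNReal.ofReal ((1 / 1024 : ℝ) ^ n) := by
    intro n k m w hw
    have hwn : (dualEdges (st n k m w) w).card = n := (Finset.mem_filter.1 hw).2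
    rw [← ofReal_measureReal]
    refine ENNReal.ofReal_le_ofReal ?_
    refine (isingMeasure_plus_real_allDisagree_le' (zdGraph d) (box d L) hβ0 le_rfl ?_).trans ?_
    · intro e he
      obtain ⟨e2, he2, rfl⟩ := Finset.mem_image.1 he
      exact hιE e2 (dualEdges_subset_edgeSet _ _ he2)
    · rw [Finset.card_image_of_injective _ (Sym2.map.injective hιi), hwn]
      exact pow_le_pow_left₀ hrate0 hrate n
  have hV : ∀ n, μ (Vv n) ≤ ENNReal.ofReal (1 / 2 * (1 / 64) ^ n) := by
    intro n
    calc μ (Vv n)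
        ≤ ∑ k ∈ Finset.range n, μ (⋃ m ∈ Finset.range (n + 1), ⋃ w ∈ good n k m, S n k m w) :=
          measure_biUnion_finset_le _ _
      _ ≤ ∑ k ∈ Finset.range n, ∑ m ∈ Finset.range (n + 1), μ (⋃ w ∈ good n k m, S n k m w) := by
          gcongr; exact measure_biUnion_finset_le _ _
      _ ≤ ∑ k ∈ Finset.range n, ∑ m ∈ Finset.range (n + 1), ∑ w ∈ good n k m, μ (S n k m w) := by
          gcongr; exact measure_biUnion_finset_le _ _
      _ ≤ ∑ k ∈ Finset.range n, ∑ m ∈ Finset.range (n + 1), ∑ w ∈ good n k m,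
            ENNReal.ofReal ((1 / 1024 : ℝ) ^ n) := by
          gcongr with k _ m _ w hw; exact hS n k m w hw
      _ ≤ ∑ k ∈ Finset.range n, ∑ m ∈ Finset.range (n + 1), ∑ w : Fin n → Fin 2 × Bool,
            ENNReal.ofReal ((1 / 1024 : ℝ) ^ n) := by
          gcongr; exact Finset.subset_univ _
      _ = ENNReal.ofReal ((n : ℝ) * (n + 1) * 4 ^ n * (1 / 1024) ^ n) := by
          rw [Finset.sum_const, Finset.sum_const, Finset.sum_const, Finset.card_range,
            Finset.card_range, Finset.card_univ, Fintype.card_fun, Fintype.card_prod,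
            Fintype.card_fin, Fintype.card_fin, Fintype.card_bool, nsmul_eq_mul, nsmul_eq_mul,
            nsmul_eq_mul, ← mul_assoc, ← mul_assoc]
          rw [ENNReal.ofReal_mul (by positivity), ENNReal.ofReal_mul (by positivity),
            ENNReal.ofReal_mul (by positivity)]
          congr 1
          · congr 1
            · rw [ENNReal.ofReal_natCast, ← Nat.cast_succ, ENNReal.ofReal_natCast]
            · rw [show ((4 : ℝ) ^ n) = ((2 * 2) ^ n : ℕ) by push_cast; ring, ENNReal.ofReal_natCast]
      _ ≤ ENNReal.ofReal (1 / 2 * (1 / 64) ^ n) := ENNReal.ofReal_le_ofReal (isingPeierls_term_le n)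
  have hsum : (∑' n, ENNReal.ofReal (1 / 2 * (1 / 64 : ℝ) ^ (n + 1))) = ENNReal.ofReal (1 / 126) := by
    have hg : Summable fun n : ℕ => (1 / 2 : ℝ) * (1 / 64) ^ (n + 1) := by
      have := ((summable_geometric_of_lt_one (by norm_num : (0:ℝ) ≤ 1 / 64) (by norm_num)).mul_left (1 / 64)).mul_left (1 / 2)
      refine this.congr fun n => ?_
      rw [pow_succ]; ring
    rw [← ENNReal.ofReal_tsum_of_nonneg (fun n => by positivity) hg]
    congr 1
    have h2 : (fun n : ℕ => (1 / 2 : ℝ) * (1 / 64) ^ (n + 1)) = fun n => (1 / 2 * (1 / 64)) * (1 / 64) ^ n := by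
      funext n; rw [pow_succ]; ring
    rw [h2, tsum_mul_left, tsum_geometric_of_lt_one (by norm_num) (by norm_num)]
    norm_num
  have hUnion : μ (⋃ n, Vv (n + 1)) ≤ ENNReal.ofReal (1 / 126) :=
    (measure_iUnion_le _).trans ((ENNReal.tsum_le_tsum fun n => hV (n + 1)).trans hsum.le)
  calc μ {σ | spinAt 0 σ = -1}
      ≤ μ ({σ | spinAt 0 σ = -1} ∩ Supp) + μ Suppᶜ := by
        refine (measure_mono ?_).trans (measure_union_le _ _)
        intro σ hσ
        by_cases h : σ ∈ Supp
        · exact Or.inl ⟨hσ, h⟩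
        · exact Or.inr h
    _ ≤ ENNReal.ofReal (1 / 126) + 0 := add_le_add ((measure_mono hsub).trans hUnion) hSupp.le
    _ ≤ ENNReal.ofReal (1 / 4) := by rw [add_zero]; exact ENNReal.ofReal_le_ofReal (by norm_num)

/-- `⟨σ₀⟩⁺_{Λ_L;β,0} ≥ ½` for `d ≥ 2`, `β ≥ 4` and every `L` (`⟨σ₀⟩ = 1 - 2μ(σ₀ = -1)`;
Friedli–Velenik 2017, proof of Thm. 3.25 (ii), eq. (3.40): "`⟨σ₀⟩⁺_{B(n);β,0} ≥ 1 - 2μ⁺(σ₀ = -1)`"). [cite: FriedliVelenik2017, §3.7.2, proof of Thm. 3.25 (ii), eq. (3.40)] -/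
theorem half_le_isingCorr_plus_box_zero (hd : 2 ≤ d) {β : ℝ} (hβ : 4 ≤ β) (L : ℕ) :
    1 / 2 ≤ isingCorr (zdGraph d) (box d L) β 0 .plus {0} := by
  set μ := isingMeasure (zdGraph d) (box d L) β 0 .plus with hμ
  have hmeasE : MeasurableSet {σ : SpinConfig (Site d) | spinAt 0 σ = -1} :=
    measurable_spinAt 0 (measurableSet_singleton _)
  have hP : μ.real {σ | spinAt 0 σ = -1} ≤ 1 / 4 := by
    rw [measureReal_def]
    have h := isingMeasure_plus_box_spinAt_zero_eq_neg_one_le hd hβ L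
    rw [← hμ] at h
    calc (μ {σ | spinAt 0 σ = -1}).toReal ≤ (ENNReal.ofReal (1 / 4)).toReal :=
          ENNReal.toReal_mono ENNReal.ofReal_ne_top h
      _ = 1 / 4 := ENNReal.toReal_ofReal (by norm_num)
  -- `σ₀ = 1 - 2·1{σ₀ = -1}`
  have hpt : ∀ σ : SpinConfig (Site d), spinProduct {0} σ =
      1 - 2 * ({σ : SpinConfig (Site d) | spinAt 0 σ = -1}.indicator (1 : SpinConfig (Site d) → ℝ) σ) := by
    intro σ
    simp only [spinProduct, Finset.prod_singleton, Set.indicator_apply, Set.mem_setOf_eq, Pi.one_apply]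
    rcases spinAt_eq_one_or_eq_neg_one 0 σ with h | h <;> rw [h] <;> norm_num
  have hint : isingCorr (zdGraph d) (box d L) β 0 .plus {0} = 1 - 2 * μ.real {σ | spinAt 0 σ = -1} := by
    rw [isingCorr, isingExpect, ← hμ]
    simp_rw [hpt]
    rw [integral_sub (integrable_const 1), integral_const, integral_const_mul,
      integral_indicator_one hmeasE]
    · simp
    · exact (integrable_const (1 : ℝ)).indicator hmeasE |>.const_mul 2
  rw [hint]
  linarith

end Peierls

end Literature.Probability.LatticeModels

namespace Literature.Probability.LatticeModels

open Percolation Filter Topology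

variable {d : ℕ}

/-- **`m*(β) ≥ ½` for `β ≥ 4`, `d ≥ 2`** (Friedli–Velenik 2017, Thm. 3.25 (ii): "for `d ≥ 2`,
`m*(β) > 0` for all `β` large enough"; the limit of `half_le_isingCorr_plus_box_zero` along boxes,
`m*(β) = ⟨σ₀⟩⁺_{β,0} = lim_L ⟨σ₀⟩⁺_{Λ_L;β,0}`). [cite: FriedliVelenik2017, Thm. 3.25 (ii)] -/
theorem half_le_spontaneousMagnetization (hd : 2 ≤ d) {β : ℝ} (hβ : 4 ≤ β) :
    1 / 2 ≤ spontaneousMagnetization d β := by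
  rw [spontaneousMagnetization_eq_plusCorr]
  have hβ0 : 0 ≤ β := le_trans (by norm_num) hβ
  exact ge_of_tendsto (hasBoxLimit_isingCorr_plus_holds (d := d) hβ0 le_rfl {0})
    (Filter.Eventually.of_forall fun L => half_le_isingCorr_plus_box_zero hd hβ L)

/-- **Discharge of `exists_spontaneousMagnetization_pos`** (crit-ising.S07; Peierls 1936;
Griffiths 1964; Friedli–Velenik 2017, Thm. 3.25 (ii)): for `d ≥ 2` there is `β ≥ 0` with
`m*(β) > 0` (namely `β = 4`, `m*(4) ≥ ½`). [cite: FriedliVelenik2017, Thm. 3.25 (ii)] [cite: Peierls1936] -/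
theorem exists_spontaneousMagnetization_pos_holds : exists_spontaneousMagnetization_pos (d := d) :=
  fun hd => ⟨4, by norm_num, lt_of_lt_of_le (by norm_num) (half_le_spontaneousMagnetization hd le_rfl)⟩

end Literature.Probability.LatticeModels
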